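import Summits.KontsevichZagierPeriods.KontsevichZagierPeriods.Theorems.FurushoPentagonDoubleShuffleInKZDilationSlot

/-!
# `DoubleShuffleInKZ` (stmt-KontsevichZagierPeriods-14665, route `FurushoPentagon`): dilation at a block, semialgebraicity

Helper file (`--supports stmt-KontsevichZagierPeriods-14665`), line "rider lever"; companion of
`FurushoPentagonDoubleShuffleInKZDilationSlot.lean`.  The cubical integrand
`f = ∏_{l<k} T_{p_l}/(1 − T_{p_{l+1}})` and the slot kernel `K = f · Σ_{l ≥ m} 1/(1 − T_{p_{l+1}})`
are `ℚ`-semialgebraic functions on the slot box `{x | x_i ∈ (0,1) (i ≠ q), x_q ∈ [0,1)}`: a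
quotient, resp. a finite sum of quotients, of `ℚ`-polynomials whose denominators do not vanish there
(`T_{p_l} ≤ S_{p_l} < 1` for `l ≥ 1`).  [Bochnak–Coste–Roy 1998, Prop. 2.2.6.]
-/

noncomputable section

open Set MeasureTheory Function
open Literature.NumberTheory.Transcendental
open Literature.ModelTheory.ExponentialFields (IsSemialgebraic)

namespace Summit.KontsevichZagierPeriods.FurushoPentagon.DoubleShuffleInKZ

section Slot

variable {N k m : ℕ}

/-! ### Semialgebraicity -/

/-- The set `{x | x_i ∈ (0,1) (i ≠ q), x_q ∈ [0,1)}` is `ℚ`-semialgebraic. [folklore] -/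
theorem isSemialgebraic_slotBox (q : Fin N) :
    IsSemialgebraic ℚ {x : Fin N → ℝ | (∀ i : Fin N, (i : ℕ) ≠ q → x i ∈ Ioo (0:ℝ) 1) ∧
      x q ∈ Ico (0:ℝ) 1} := by
  have h1 : IsSemialgebraic ℚ {x : Fin N → ℝ | ∀ i : Fin N, (i : ℕ) ≠ q → 0 < x i} := by
    have : {x : Fin N → ℝ | ∀ i : Fin N, (i : ℕ) ≠ q → 0 < x i} =
        ⋂ i ∈ (Finset.univ.filter fun i : Fin N => (i : ℕ) ≠ q),
          {x | 0 < MvPolynomial.aeval x (MvPolynomial.X i : MvPolynomial (Fin N) ℚ)} := by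
      ext x; simp
    rw [this]
    exact IsSemialgebraic.biInter _ _ fun i _ =>
      Literature.ModelTheory.ExponentialFields.isSemialgebraic_setOf_eval_pos _
  have h2 : IsSemialgebraic ℚ {x : Fin N → ℝ | ∀ i : Fin N, x i < 1} := by
    have : {x : Fin N → ℝ | ∀ i : Fin N, x i < 1} = ⋂ i ∈ (Finset.univ : Finset (Fin N)),
        {x | 0 < MvPolynomial.aeval x (MvPolynomial.C 1 - MvPolynomial.X i : MvPolynomial (Fin N) ℚ)} := by
      ext x; simp [sub_pos]
    rw [this]
    exact IsSemialgebraic.biInter _ _ fun i _ =>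
      Literature.ModelTheory.ExponentialFields.isSemialgebraic_setOf_eval_pos _
  have h3 : IsSemialgebraic ℚ {x : Fin N → ℝ | 0 ≤ x q} := by
    simpa using Literature.ModelTheory.ExponentialFields.isSemialgebraic_setOf_eval_le
      (k := ℚ) (R := ℝ) (0 : MvPolynomial (Fin N) ℚ) (MvPolynomial.X q)
  convert (h1.inter h2).inter h3 using 1
  ext x
  simp only [mem_setOf_eq, mem_inter_iff, mem_Ioo, mem_Ico]
  constructor
  · rintro ⟨h, hq0, hq1⟩
    refine ⟨⟨fun i hi => (h i hi).1, fun i => ?_⟩, hq0⟩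
    by_cases hi : (i : ℕ) = q
    · rw [Fin.ext hi]; exact hq1
    · exact (h i hi).2
  · rintro ⟨⟨h0, h1⟩, hq0⟩
    exact ⟨fun i hi => ⟨h0 i hi, h1 i⟩, hq0, h1 q⟩

/-- The partial products `T_r` are `ℚ`-polynomials. [folklore] -/
theorem exists_mvPolynomial_pprod (T : ℕ → (Fin N → ℝ) → ℝ)
    (hT : ∀ r x, T r x = ∏ j : Fin N, if (j : ℕ) < r then x j else 1) :
    ∃ P : ℕ → MvPolynomial (Fin N) ℚ, ∀ (r : ℕ) (x : Fin N → ℝ), MvPolynomial.aeval x (P r) = T r x := by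
  refine ⟨fun r => ∏ j : Fin N, if (j : ℕ) < r then MvPolynomial.X j else 1, fun r x => ?_⟩
  rw [hT, map_prod]
  refine Finset.prod_congr rfl fun j _ => ?_
  split_ifs <;> simp

/-- On the slot box the denominators `1 − T_{p_l}` (`l ≥ 1`) are positive. [folklore] -/
theorem slotBox_den_pos (hN : 2 ≤ N) (q : Fin N) (T S : ℕ → (Fin N → ℝ) → ℝ)
    (hT : ∀ r x, T r x = ∏ j : Fin N, if (j : ℕ) < r then x j else 1)
    (hS : ∀ r x, S r x = ∏ j : Fin N, if (j : ℕ) < r ∧ (j : ℕ) ≠ q then x j else 1)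
    (p : ℕ → ℕ) (hp2 : ∀ l, 1 ≤ l → 2 ≤ p l) {x : Fin N → ℝ}
    (hx : x ∈ {x : Fin N → ℝ | (∀ i : Fin N, (i : ℕ) ≠ q → x i ∈ Ioo (0:ℝ) 1) ∧ x q ∈ Ico (0:ℝ) 1})
    {l : ℕ} (hl : 1 ≤ l) : 0 < 1 - T (p l) x := by
  have h := pprod_update q T S hT hS (p l) x (x q)
  rw [update_eq_self] at h
  rw [h]
  split_ifs
  · exact one_sub_mul_sprod_pos hN q S hS p hp2 hx.1 hx.2.2.le hl
  · exact one_sub_mul_sprod_pos hN q S hS p hp2 hx.1 le_rfl hl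

/-- **Semialgebraicity** of the cubical integrand `f` and of the kernel `K` on the slot box
`{x | x_i ∈ (0,1) (i ≠ q), x_q ∈ [0,1)}` (quotient, resp. finite sum of quotients, of
`ℚ`-polynomials with non-vanishing denominators). [cite: BochnakCosteRoy1998, Prop. 2.2.6] -/
theorem slotBox_isSemialgebraicFunOn (hN : 2 ≤ N) (q : Fin N) (T S : ℕ → (Fin N → ℝ) → ℝ)
    (hT : ∀ r x, T r x = ∏ j : Fin N, if (j : ℕ) < r then x j else 1)
    (hS : ∀ r x, S r x = ∏ j : Fin N, if (j : ℕ) < r ∧ (j : ℕ) ≠ q then x j else 1)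
    (p : ℕ → ℕ) (hp2 : ∀ l, 1 ≤ l → 2 ≤ p l) (f K : (Fin N → ℝ) → ℝ)
    (hf : ∀ x, f x = ∏ l : Fin k, T (p l) x / (1 - T (p (l + 1)) x))
    (hK : ∀ x, K x = f x * ∑ l : Fin k, if m ≤ (l : ℕ) then 1 / (1 - T (p (l + 1)) x) else 0) :
    IsSemialgebraicFunOn ℚ {x : Fin N → ℝ | (∀ i : Fin N, (i : ℕ) ≠ q → x i ∈ Ioo (0:ℝ) 1) ∧
      x q ∈ Ico (0:ℝ) 1} f ∧
    IsSemialgebraicFunOn ℚ {x : Fin N → ℝ | (∀ i : Fin N, (i : ℕ) ≠ q → x i ∈ Ioo (0:ℝ) 1) ∧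
      x q ∈ Ico (0:ℝ) 1} K := by
  have hB := isSemialgebraic_slotBox q
  obtain ⟨P, hP⟩ := exists_mvPolynomial_pprod T hT
  set A : MvPolynomial (Fin N) ℚ := ∏ l : Fin k, P (p l) with hA_def
  set Bd : MvPolynomial (Fin N) ℚ := ∏ l : Fin k, (1 - P (p (l + 1))) with hBd_def
  have hA : ∀ x, MvPolynomial.aeval x A = ∏ l : Fin k, T (p l) x := fun x => by
    rw [hA_def, map_prod]; exact Finset.prod_congr rfl fun l _ => hP _ x
  have hBd : ∀ x, MvPolynomial.aeval x Bd = ∏ l : Fin k, (1 - T (p (l + 1)) x) := fun x => by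
    rw [hBd_def, map_prod]
    exact Finset.prod_congr rfl fun l _ => by rw [map_sub, map_one, hP]
  have key : ∀ x, f x = MvPolynomial.aeval x A / MvPolynomial.aeval x Bd := fun x => by
    rw [hf, hA, hBd, Finset.prod_div_distrib]
  have hden : ∀ x ∈ {x : Fin N → ℝ | (∀ i : Fin N, (i : ℕ) ≠ q → x i ∈ Ioo (0:ℝ) 1) ∧
      x q ∈ Ico (0:ℝ) 1}, ∀ l : ℕ, 1 ≤ l → 1 - T (p l) x ≠ 0 := fun x hx l hl =>
    (slotBox_den_pos hN q T S hT hS p hp2 hx hl).ne'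
  have hBne : ∀ x ∈ {x : Fin N → ℝ | (∀ i : Fin N, (i : ℕ) ≠ q → x i ∈ Ioo (0:ℝ) 1) ∧
      x q ∈ Ico (0:ℝ) 1}, MvPolynomial.aeval x Bd ≠ 0 := fun x hx => by
    rw [hBd]; exact Finset.prod_ne_zero_iff.mpr fun l _ => hden x hx _ (Nat.succ_pos l)
  have hfsa : IsSemialgebraicFunOn ℚ {x : Fin N → ℝ | (∀ i : Fin N, (i : ℕ) ≠ q → x i ∈ Ioo (0:ℝ) 1) ∧
      x q ∈ Ico (0:ℝ) 1} f :=
    (isSemialgebraicFunOn_aeval_div_aeval hB A Bd hBne).congr fun x _ => (key x).symm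
  refine ⟨hfsa, ?_⟩
  classical
  refine (KZ.isSemialgebraicFunOn_finset_sum (Finset.univ.filter fun l : Fin k => m ≤ (l : ℕ)) hB
    (f := fun l x => MvPolynomial.aeval x A / MvPolynomial.aeval x (Bd * (1 - P (p (l + 1)))))
    fun l _ => isSemialgebraicFunOn_aeval_div_aeval hB _ _ fun x hx => ?_).congr fun x hx => ?_
  · rw [map_mul, map_sub, map_one, hP]
    exact mul_ne_zero (hBne x hx) (hden x hx _ (Nat.succ_pos l))
  · show (∑ l ∈ Finset.univ.filter (fun l : Fin k => m ≤ (l : ℕ)),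
        MvPolynomial.aeval x A / MvPolynomial.aeval x (Bd * (1 - P (p (l + 1))))) = K x
    rw [hK, key x, Finset.mul_sum, Finset.sum_filter]
    refine Finset.sum_congr rfl fun l _ => ?_
    split_ifs
    · rw [map_mul, map_sub, map_one, hP, mul_one_div, div_div]
    · rw [mul_zero]

end Slot

end Summit.KontsevichZagierPeriods.FurushoPentagon.DoubleShuffleInKZ
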